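import Summits.Ventures.DiscreteObjects.PP12.FanoFiveIncMatrix

/-!
# Labelled Fano planes: joins, meets and three-point lines (kernel; tools for the uniqueness of the plane of order 2)
Framing: lottery ticket; floor = certified bounds/negative ranges.

Cell pub-namedobj (venture DiscreteObjects), target (M), designs gen 16. For `I : Fin 7 → Fin 7 → Bool` with `FanoFive.IsIncidence I`
(`FanoFiveIncMatrix`: every point on 3 lines, every line through 3 points, two points on exactly one common line): the join of two points
(`exists_join`, `join_unique`), the points of a line as three named points (`three_points`, `mem_iff_of_three`), the lines through a point
(`three_lines`, `line_iff_of_three`), and the standard labelled Fano plane `stdI` with `isIncidence_stdI`. Used by `FanoUnique`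
(every labelled Fano incidence is isomorphic to `stdI`). Classical facts; no census statement involved. No `sorry`, no new axioms.
-/

namespace Summit.Ventures.DiscreteObjects.PP12

open Finset

namespace FanoFive

/-- the standard Fano plane: lines `{0,1,2}, {0,3,4}, {0,5,6}, {1,3,5}, {1,4,6}, {2,3,6}, {2,4,5}` -/
def stdI (x μ : Fin 7) : Bool :=
  match μ with
  | 0 => x = 0 || x = 1 || x = 2
  | 1 => x = 0 || x = 3 || x = 4
  | 2 => x = 0 || x = 5 || x = 6
  | 3 => x = 1 || x = 3 || x = 5
  | 4 => x = 1 || x = 4 || x = 6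
  | 5 => x = 2 || x = 3 || x = 6
  | 6 => x = 2 || x = 4 || x = 5

/-- the standard Fano plane is a labelled Fano incidence -/
theorem isIncidence_stdI : IsIncidence stdI := by
  unfold IsIncidence
  refine ⟨by decide, by decide, by decide⟩

variable {I : Fin 7 → Fin 7 → Bool} (hI : IsIncidence I)
include hI

/-- two distinct points lie on a common line -/
theorem exists_join {x y : Fin 7} (hxy : x ≠ y) : ∃ μ, I x μ = true ∧ I y μ = true := by
  have h := hI.2.2 x y hxy
  obtain ⟨μ, hμ⟩ := Finset.card_eq_one.1 h
  have : μ ∈ univ.filter fun ν : Fin 7 => I x ν = true ∧ I y ν = true := by rw [hμ]; exact mem_singleton_self μ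
  simp only [mem_filter, mem_univ, true_and] at this
  exact ⟨μ, this⟩

/-- … and on only one -/
theorem join_unique {x y : Fin 7} (hxy : x ≠ y) {μ ν : Fin 7} (h1 : I x μ = true) (h2 : I y μ = true) (h3 : I x ν = true) (h4 : I y ν = true) :
    μ = ν := by
  have h := hI.2.2 x y hxy
  obtain ⟨μ₀, hμ₀⟩ := Finset.card_eq_one.1 h
  have e1 : μ ∈ univ.filter fun ν : Fin 7 => I x ν = true ∧ I y ν = true := by simp [h1, h2]
  have e2 : ν ∈ univ.filter fun ν : Fin 7 => I x ν = true ∧ I y ν = true := by simp [h3, h4]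
  rw [hμ₀, mem_singleton] at e1 e2
  rw [e1, e2]

/-- two distinct lines share at most one point -/
theorem meet_unique {μ ν : Fin 7} (hμν : μ ≠ ν) {x y : Fin 7} (h1 : I x μ = true) (h2 : I x ν = true) (h3 : I y μ = true) (h4 : I y ν = true) :
    x = y := by
  by_contra hxy
  exact hμν (join_unique hI hxy h1 h3 h2 h4)

/-- **the three points of a line** -/
theorem three_points (μ : Fin 7) : ∃ a b c : Fin 7, a ≠ b ∧ a ≠ c ∧ b ≠ c ∧ ∀ z, I z μ = true ↔ z = a ∨ z = b ∨ z = c := by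
  obtain ⟨a, b, c, hab, hac, hbc, hS⟩ := Finset.card_eq_three.1 (hI.2.1 μ)
  refine ⟨a, b, c, hab, hac, hbc, fun z => ?_⟩
  have : z ∈ (univ.filter fun x : Fin 7 => I x μ = true) ↔ z ∈ ({a, b, c} : Finset (Fin 7)) := by rw [hS]
  simpa using this

/-- **the three lines through a point** -/
theorem three_lines (x : Fin 7) : ∃ a b c : Fin 7, a ≠ b ∧ a ≠ c ∧ b ≠ c ∧ ∀ μ, I x μ = true ↔ μ = a ∨ μ = b ∨ μ = c := by
  obtain ⟨a, b, c, hab, hac, hbc, hS⟩ := Finset.card_eq_three.1 (hI.1 x)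
  refine ⟨a, b, c, hab, hac, hbc, fun μ => ?_⟩
  have : μ ∈ (univ.filter fun ν : Fin 7 => I x ν = true) ↔ μ ∈ ({a, b, c} : Finset (Fin 7)) := by rw [hS]
  simpa using this

/-- a line through three known distinct points has exactly these points -/
theorem mem_iff_of_three {μ : Fin 7} {u v w : Fin 7} (hu : I u μ = true) (hv : I v μ = true) (hw : I w μ = true) (huv : u ≠ v) (huw : u ≠ w)
    (hvw : v ≠ w) (z : Fin 7) : I z μ = true ↔ z = u ∨ z = v ∨ z = w := by
  have h3 := hI.2.1 μ
  have hsub : ({u, v, w} : Finset (Fin 7)) ⊆ univ.filter fun x : Fin 7 => I x μ = true := by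
    intro t ht
    simp only [mem_insert, mem_singleton] at ht
    rcases ht with rfl | rfl | rfl <;> simp [hu, hv, hw]
  have hc : ({u, v, w} : Finset (Fin 7)).card = 3 := by
    rw [card_insert_of_notMem (by simp [huv, huw]), card_pair hvw]
  have heq := Finset.eq_of_subset_of_card_le hsub (by rw [hc, h3])
  have : z ∈ (univ.filter fun x : Fin 7 => I x μ = true) ↔ z ∈ ({u, v, w} : Finset (Fin 7)) := by rw [heq]
  simpa using this

/-- **the third point** of a line through two known points -/
theorem third_point {μ : Fin 7} {u v : Fin 7} (hu : I u μ = true) (hv : I v μ = true) (huv : u ≠ v) :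
    ∃ w, I w μ = true ∧ w ≠ u ∧ w ≠ v ∧ ∀ z, I z μ = true ↔ z = u ∨ z = v ∨ z = w := by
  obtain ⟨a, b, c, hab, hac, hbc, hS⟩ := three_points hI μ
  have hu' := (hS u).1 hu
  have hv' := (hS v).1 hv
  -- the third point is the one of a, b, c different from u, v
  have key : ∃ w, (w = a ∨ w = b ∨ w = c) ∧ w ≠ u ∧ w ≠ v := by
    rcases hu' with rfl | rfl | rfl <;> rcases hv' with rfl | rfl | rfl
    all_goals first
      | exact absurd rfl huv
      | (refine ⟨_, Or.inl rfl, ?_, ?_⟩ <;> first | assumption | exact Ne.symm ‹_›)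
      | (refine ⟨_, Or.inr (Or.inl rfl), ?_, ?_⟩ <;> first | assumption | exact Ne.symm ‹_›)
      | (refine ⟨_, Or.inr (Or.inr rfl), ?_, ?_⟩ <;> first | assumption | exact Ne.symm ‹_›)
  obtain ⟨w, hw, hwu, hwv⟩ := key
  have hwμ : I w μ = true := (hS w).2 hw
  exact ⟨w, hwμ, hwu, hwv, mem_iff_of_three hI hu hv hwμ huv (Ne.symm hwu) (Ne.symm hwv)⟩

/-- **the two other points** of a line through a known point -/
theorem two_others {μ u : Fin 7} (hu : I u μ = true) :
    ∃ v w, I v μ = true ∧ I w μ = true ∧ u ≠ v ∧ u ≠ w ∧ v ≠ w ∧ ∀ z, I z μ = true ↔ z = u ∨ z = v ∨ z = w := by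
  obtain ⟨a, b, c, hab, hac, hbc, hS⟩ := three_points hI μ
  have ha := (hS a).2 (Or.inl rfl)
  have hb := (hS b).2 (Or.inr (Or.inl rfl))
  have hc := (hS c).2 (Or.inr (Or.inr rfl))
  rcases (hS u).1 hu with rfl | rfl | rfl
  · exact ⟨b, c, hb, hc, hab, hac, hbc, hS⟩
  · exact ⟨a, c, ha, hc, Ne.symm hab, hbc, hac, fun z => by rw [hS z]; tauto⟩
  · exact ⟨a, b, ha, hb, Ne.symm hac, Ne.symm hbc, hab, fun z => by rw [hS z]; tauto⟩

omit hI in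
/-- rows of the standard incidence are pairwise distinct -/
theorem stdI_row_inj : ∀ i i' : Fin 7, (∀ j, stdI i j = stdI i' j) → i = i' := by decide

omit hI in
/-- columns of the standard incidence are pairwise distinct -/
theorem stdI_col_inj : ∀ j j' : Fin 7, (∀ i, stdI i j = stdI i j') → j = j' := by decide

end FanoFive

end Summit.Ventures.DiscreteObjects.PP12
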